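import Literature.AlgebraicGeometry.Motives.FlatFamilyCutOutByDegreeEquations
import Literature.AlgebraicGeometry.Modules.VanishingLocusFiniteLocallyFree
import HarnessLib

/-!
# The ideal `V := ⨆_{m ≥ e₀} V(α_m)` of «the sub-family lies in the fixed closed `W`»: construction and its functor of points in terms of `b^* α_m = 0`

Topic `Literature/AlgebraicGeometry/Motives`, namespace `Literature.AlgebraicGeometry.Motives`.  THEOREMS ONLY (no definition, no instance, no notation, no named fact,
no `sorry`); universe `0` (the universe of ★ PART B `Motives/FlatFamilyCutOutByDegreeEquations`).  Cell `hodgecm-mathlib` (D-0151 ∕ FLOOR 0), P1 sub-line F-4 layer 2,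
sub-stub (II-b), brick **(b1) FILE 2A-α (2)+(3)** of B-p20 (g14)'s blueprint `BLUEPRINT-F4-IIb-b1-FILE2A` §2: for TWO closed families `i : Z ⟶ 𝐏(ι; T)`, `iW : W ⟶ 𝐏(ι; T)`
with their monomial maps `ψ_{Z,m}`, `ψ_{W,m}` (PART B's binders `(ψ, hψ)`, which EXIST: ★-to-be `Motives/SubschemeMonomialMap`), the morphisms
**`α_m := kernel.ι ψ_{W,m} ≫ ψ_{Z,m} : K_W(m) ⟶ (p_Z)_* 𝒪_Z(m)`** («restrict the degree-`m` forms vanishing on `W` to `Z`») and the ideal sheaf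
**`V := ⨆_{m ≥ e₀} vanishingIdeal α_m`** on `T`; its functor of points: **`V ≤ ker b^♯ ↔ ∀ m ≥ e₀, b^* α_m = 0`** (Fulton B.3.4 ∕ ★ `Modules/VanishingLocusOfHom` for each
`m`, `iSup_le_iff`), provided `(p_Z)_* 𝒪_Z(m)` is finite locally free for `m ≥ e₀` (the Hilbert-scheme letter `hrk`).  The identification of «`∀ m ≥ e₀, b^* α_m = 0`» with
«`Z_{T′} ⊂ W_{T′}`» is FILE 2A-β (affine dictionary + ★-to-be `Morphisms/ProjectiveSubschemeContainmentByForms`) — not here.  Count-neutral capital; HC_CM is proved only modulo the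
7 printed citations until rung 0 closes — nothing here is about HC.

* `isAffineLocalizing_kernel` — `K_W(m) = kernel ψ_{W,m}` is affine-localizing (★ `isAffineLocalizing_kernel_monomialMap`, no flatness used);
* **`exists_idealSheafData_le_ker_iff_forall_pullback_map_eq_zero`** — the construction of `V` with its functor of points;
* `le_ker_of_forall` ∕ `pullback_map_eq_zero_of_le_ker` — the two directions unbundled for a GIVEN family of `V(α_m)` (no `∃`).

## References
* [Fulton1998] W. Fulton, *Intersection Theory*, 2nd ed. (1998), B.3.4 (PDF p. 410) (the zero scheme of a section of a bundle and its universal property).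
* [Kollar1996] J. Kollár, *Rational Curves on Algebraic Varieties* (1996), I Thm. 1.10, proof (the equations of `Hilb(W) ⊂ Hilb(ℙ)`).
* [Hartshorne1977] R. Hartshorne, *Algebraic Geometry* (1977), II Prop. 5.9 (PDF p. 146), II Ex. 3.11 (b) (p. 92).
-/

noncomputable section

-- `TopCat.Presheaf`/`Scheme.Modules` are not reducible (as in Mathlib's `AlgebraicGeometry/Modules`).
set_option backward.isDefEq.respectTransparency false

open CategoryTheory CategoryTheory.Limits AlgebraicGeometry TopologicalSpace Opposite
open Literature.AlgebraicGeometry.Modules Literature.AlgebraicGeometry.Modules.SerreTwist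

namespace Literature.AlgebraicGeometry.Motives

variable {ι : Type} {T Z W : Scheme.{0}} [IsLocallyNoetherian T] (i : Z ⟶ Morphisms.projectiveSpace ι T) [IsClosedImmersion i]
  (iW : W ⟶ Morphisms.projectiveSpace ι T) [IsClosedImmersion iW]
  (ψZ : ∀ m : ℕ, freeModule T (Fin m → Fin (Nat.card ι + 1)) ⟶ (Scheme.Modules.pushforward (i ≫ Morphisms.projectiveSpaceFst ι T)).obj
    (twistMod (i ≫ pullback.snd (terminal.from T) (terminal.from (Morphisms.projectiveSpaceInt ι))) (unitModule Z) m))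
  (ψW : ∀ m : ℕ, freeModule T (Fin m → Fin (Nat.card ι + 1)) ⟶ (Scheme.Modules.pushforward (iW ≫ Morphisms.projectiveSpaceFst ι T)).obj
    (twistMod (iW ≫ pullback.snd (terminal.from T) (terminal.from (Morphisms.projectiveSpaceInt ι))) (unitModule W) m))
  (e₀ : ℕ)

omit [IsClosedImmersion i] in
/-- `K_W(m) = kernel ψ_{W,m}` is affine-localizing: a kernel between affine-localizing modules (★ `isAffineLocalizing_kernel_monomialMap`; no flatness, no letter
`hψ` is used). [cite: Hartshorne1977, II Prop. 5.7 (p. 114)] -/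
theorem isAffineLocalizing_kernel (m : ℕ) : IsAffineLocalizing (kernel (ψW m)) :=
  isAffineLocalizing_kernel_monomialMap iW m (ψW m)

omit [IsClosedImmersion i] in
/-- **One degree: `V(α_m) ≤ ker b^♯ ↔ b^* α_m = 0`** for `α_m = kernel.ι ψ_{W,m} ≫ ψ_{Z,m}`, when `(p_Z)_* 𝒪_Z(m)` is finite locally free (★ `vanishingIdeal_le_ker_iff` with the frame
system of a finite locally free module; `K_W(m)` affine-localizing). [cite: Fulton1998, B.3.4 (PDF p. 410)] -/
theorem vanishingIdeal_restrictForms_le_ker_iff (m : ℕ)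
    (hF : IsFiniteLocallyFree ((Scheme.Modules.pushforward (i ≫ Morphisms.projectiveSpaceFst ι T)).obj
      (twistMod (i ≫ pullback.snd (terminal.from T) (terminal.from (Morphisms.projectiveSpaceInt ι))) (unitModule Z) m)))
    {T' : Scheme.{0}} (b : T' ⟶ T) :
    vanishingIdeal (kernel.ι (ψW m) ≫ ψZ m) ≤ b.ker ↔ (Scheme.Modules.pullback b).map (kernel.ι (ψW m) ≫ ψZ m) = 0 :=
  vanishingIdeal_le_ker_iff _ b (frameSystemOfIsFiniteLocallyFree hF) (isAffineLocalizing_kernel iW ψW m)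
    (isAffineLocalizing_dual_of_isFiniteLocallyFree hF)

omit [IsClosedImmersion i] in
/-- **`⨆_{m ≥ e₀} V(α_m) ≤ ker b^♯ ↔ ∀ m ≥ e₀, b^* α_m = 0`** (`iSup_le_iff` and the one-degree statement), for `(p_Z)_* 𝒪_Z(m)` finite locally free beyond `e₀`.
[cite: Fulton1998, B.3.4 (PDF p. 410)] [cite: Kollar1996, I Thm. 1.10 (proof)] -/
theorem iSup_vanishingIdeal_restrictForms_le_ker_iff
    (hF : ∀ m, e₀ ≤ m → IsFiniteLocallyFree ((Scheme.Modules.pushforward (i ≫ Morphisms.projectiveSpaceFst ι T)).obj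
      (twistMod (i ≫ pullback.snd (terminal.from T) (terminal.from (Morphisms.projectiveSpaceInt ι))) (unitModule Z) m)))
    {T' : Scheme.{0}} (b : T' ⟶ T) :
    (⨆ m : {m : ℕ // e₀ ≤ m}, vanishingIdeal (kernel.ι (ψW m) ≫ ψZ m)) ≤ b.ker ↔
      ∀ m, e₀ ≤ m → (Scheme.Modules.pullback b).map (kernel.ι (ψW m) ≫ ψZ m) = 0 := by
  rw [iSup_le_iff]
  constructor
  · intro h m hm
    exact (vanishingIdeal_restrictForms_le_ker_iff i iW ψZ ψW m (hF m hm) b).mp (h ⟨m, hm⟩)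
  · intro h m
    exact (vanishingIdeal_restrictForms_le_ker_iff i iW ψZ ψW m (hF m m.2) b).mpr (h m m.2)

omit [IsClosedImmersion i] in
/-- **THE IDEAL OF «THE SUB-FAMILY LIES IN `W`» AND ITS FUNCTOR OF POINTS (form level).**  For closed `Z, W ⊂ 𝐏(ι; T)` with monomial maps `ψ_{Z,m}`, `ψ_{W,m}` and
`(p_Z)_* 𝒪_Z(m)` finite locally free for `m ≥ e₀` (e.g. `HasRank … (R m)`, ★ `HasRank.isFiniteLocallyFree'`), there is an ideal sheaf `V` on `T` (namely
`⨆_{m ≥ e₀} V(kernel.ι ψ_{W,m} ≫ ψ_{Z,m})`) such that for EVERY `b : T′ → T`: `V ≤ ker b^♯` iff `b^*(kernel.ι ψ_{W,m} ≫ ψ_{Z,m}) = 0` for all `m ≥ e₀` — «the degree-`m` forms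
vanishing on `W` vanish on `Z` after base change along `b`, for all large `m`». [cite: Kollar1996, I Thm. 1.10 (proof)] [cite: Fulton1998, B.3.4 (PDF p. 410)] -/
theorem exists_idealSheafData_le_ker_iff_forall_pullback_map_eq_zero
    (hF : ∀ m, e₀ ≤ m → IsFiniteLocallyFree ((Scheme.Modules.pushforward (i ≫ Morphisms.projectiveSpaceFst ι T)).obj
      (twistMod (i ≫ pullback.snd (terminal.from T) (terminal.from (Morphisms.projectiveSpaceInt ι))) (unitModule Z) m))) :
    ∃ V : T.IdealSheafData, ∀ ⦃T' : Scheme.{0}⦄ (b : T' ⟶ T),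
      V ≤ b.ker ↔ ∀ m, e₀ ≤ m → (Scheme.Modules.pullback b).map (kernel.ι (ψW m) ≫ ψZ m) = 0 :=
  ⟨⨆ m : {m : ℕ // e₀ ≤ m}, vanishingIdeal (kernel.ι (ψW m) ≫ ψZ m), fun _ b => iSup_vanishingIdeal_restrictForms_le_ker_iff i iW ψZ ψW e₀ hF b⟩

omit [IsClosedImmersion i] [IsLocallyNoetherian T] in
/-- The rank form of the hypothesis: the Hilbert-scheme letter `hrk` gives the finite local freeness beyond `e₀` (★ `HasRank.isFiniteLocallyFree'`).
[cite: Mumford1966CurvesSurface, Lecture 15 (II.) (p. 106)] -/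
theorem isFiniteLocallyFree_of_hasRank_twists (R : ℕ → ℕ)
    (hrk : ∀ m, e₀ ≤ m → HasRank ((Scheme.Modules.pushforward (i ≫ Morphisms.projectiveSpaceFst ι T)).obj
      (twistMod (i ≫ pullback.snd (terminal.from T) (terminal.from (Morphisms.projectiveSpaceInt ι))) (unitModule Z) m)) (R m)) :
    ∀ m, e₀ ≤ m → IsFiniteLocallyFree ((Scheme.Modules.pushforward (i ≫ Morphisms.projectiveSpaceFst ι T)).obj
      (twistMod (i ≫ pullback.snd (terminal.from T) (terminal.from (Morphisms.projectiveSpaceInt ι))) (unitModule Z) m)) :=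
  fun m hm => HasRank.isFiniteLocallyFree' (hrk m hm)

end Literature.AlgebraicGeometry.Motives

end
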